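import Literature.Geometry.Riemannian.RicciFlowScalarMaximumPrinciple
import Literature.Geometry.Riemannian.HeatEquationFamily
import Literature.Geometry.Lorentzian.MassCapacityHarmonic
import Literature.Geometry.Lorentzian.HessianLinear
import Mathlib.Geometry.Manifold.PartitionOfUnity
import HarnessLib

/-!
# The parabolic minimum principle on `M × M × [t₁, t₂]` against supersolutions in the barrier
# sense (the comparison step of Bamler 2020a, Cor. 3.6)

R. Bamler, *Entropy and heat kernel bounds on a Ricci flow background*, arXiv:2008.07093 (2020a),
proof of Cor. 3.6: "By Theorem 3.5 and the maximum principle (applied to viscosity [barrier]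
supersolutions) we have `d_t² − u + H_n (t − t₁) ≥ 0` on `M × M × [t₁, t₂]`", where `u` solves
`∂ₜu = (Δ_x + Δ_y) u` with `u(t₁) = d_{t₁}²`. We prove this comparison for a family `h` of
Riemannian metrics on a compact manifold `M`:

* `laplaceBeltrami_nonneg_of_isLocalMin` — **`Δ_g f (x) ≥ 0` at a local minimum** of a function
  that is `C²` near `x` (globalisation by a smooth bump + `laplaceBeltrami_nonpos_of_isMaxOn`);
* `hasDerivAt_nonpos_of_isLocalMin_left` — `φ′(t₀) ≤ 0` if `φ(t) ≥ φ(t₀)` for `t < t₀` near `t₀`;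
* `barrier_minimum_principle` — let `ψ, U : M → M → ℝ → ℝ` be continuous on `M × M × [t₁, t₂]`,
  `U` of class `C²` in `x` and in `y` and differentiable in `t` with
  `∂ₜU = Δ_x U + Δ_y U` at every `(x, y, t)`, `t ∈ (t₁, t₂]`, `U(t₁) ≤ ψ(t₁)`, and suppose `ψ` is a
  SUPERSOLUTION IN THE BARRIER SENSE: at every `(x, y, t)`, `t ∈ (t₁, t₂]`, for every `η > 0` there
  is an upper barrier `b ≥ ψ` near `(x, y, t)` with `b(x, y, t) = ψ(x, y, t)`, `C²` slices, and
  `∂ₜb − Δ_x b − Δ_y b ≥ −c − η` at the point. Then `U ≤ ψ + c (t − t₁)` on `M × M × [t₁, t₂]`.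

Everything is proved; no definitions, no named facts.

## References

* R. H. Bamler, *Entropy and heat kernel bounds on a Ricci flow background*, arXiv:2008.07093
  (2020), §3, proof of Cor. 3.6. [Bamler2020Entropy]
* E. Calabi, *An extension of E. Hopf's maximum principle with an application to Riemannian
  geometry*, Duke Math. J. 25 (1958) (barrier sense).
-/

noncomputable section

open Bundle Set Function Filter Manifold TopologicalSpace
open scoped Manifold ContDiff Topology

namespace Literature.Geometry.Riemannian

open Lorentzian Lorentzian.PseudoRiemannianMetric

section LocalMin

variable {m : ℕ} {H : Type*} [TopologicalSpace H]
  {I : ModelWithCorners ℝ (EuclideanSpace ℝ (Fin m)) H} [I.Boundaryless]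
  {M : Type*} [TopologicalSpace M] [ChartedSpace H M] [IsManifold I ∞ M]
  [T2Space M] [CompactSpace M]

/-- **`Δ_g f (x) ≥ 0` at a local minimum** of a function `C²` near `x`, for a Riemannian metric
`g` (globalise `f` by a smooth bump equal to `1` near `x` and supported where `f` is `C²` and
`≥ f x`, then `laplaceBeltrami_nonpos_of_isMaxOn` for the negative; the Laplacian is local,
`dalembertian_congr_of_eventuallyEq`). [cite: Topping2006, Thm. 3.1.1 (proof, p. 35)] -/
theorem laplaceBeltrami_nonneg_of_isLocalMin
    (g : PseudoRiemannianMetric I ∞ (EuclideanSpace ℝ (Fin m)) (TangentSpace I : M → Type _))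
    (hg : g.IsRiemannian) {f : M → ℝ} {x : M}
    (hf : ∀ᶠ y in 𝓝 x, ContMDiffAt I 𝓘(ℝ, ℝ) 2 f y) (hmin : IsLocalMin f x) :
    0 ≤ g.laplaceBeltrami f x := by
  haveI := g.hasLeviCivita
  haveI : Fact (1 ≤ (∞ : ℕ∞ω)) := ⟨by exact_mod_cast le_top⟩
  haveI : LocallyCompactSpace M := inferInstance
  -- an open neighbourhood `O` of `x` where `f` is `C²` and `≥ f x`
  obtain ⟨O, hO, hOopen, hxO⟩ : ∃ O : Set M, (∀ y ∈ O, ContMDiffAt I 𝓘(ℝ, ℝ) 2 f y ∧ f x ≤ f y) ∧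
      IsOpen O ∧ x ∈ O := by
    obtain ⟨O, hO, hOo, hxO⟩ := mem_nhds_iff.1 (hf.and hmin)
    exact ⟨O, fun y hy ↦ hO hy, hOo, hxO⟩
  -- a closed neighbourhood `C ⊆ O` of `x` and a smooth bump `χ = 1` near `x`, `χ = 0` off `C`
  obtain ⟨C, hCn, hCc, hCO⟩ : ∃ C ∈ 𝓝 x, IsClosed C ∧ C ⊆ O :=
    (closed_nhds_basis x).mem_iff.1 (hOopen.mem_nhds hxO) |>.imp fun C h ↦ ⟨h.1.1, h.1.2, h.2⟩
  obtain ⟨χ, hχ1, hχ0, hχ01⟩ := exists_contMDiffMap_one_nhds_of_subset_interior I (n := (⊤ : ℕ∞))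
    (isClosed_singleton (x := x)) (t := C)
    (singleton_subset_iff.2 (mem_interior_iff_mem_nhds.2 hCn))
  -- the globalised function `F = f x + χ (f − f x)`
  set F : M → ℝ := fun y ↦ f x + χ y * (f y - f x) with hF
  have hχs : ContMDiff I 𝓘(ℝ, ℝ) ∞ χ := χ.contMDiff
  have hFs : ContMDiff I 𝓘(ℝ, ℝ) 2 F := by
    intro y
    by_cases hy : y ∈ O
    · have hfy : ContMDiffAt I 𝓘(ℝ, ℝ) 2 f y := (hO y hy).1
      exact contMDiffAt_const.add (((hχs.of_le (by norm_cast)).contMDiffAt).mul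
        (hfy.sub contMDiffAt_const))
    · -- off `C` (an open set containing `y`), `F` is constant
      have hyC : y ∉ C := fun h ↦ hy (hCO h)
      have hev : F =ᶠ[𝓝 y] fun _ ↦ f x := by
        filter_upwards [hCc.isOpen_compl.mem_nhds hyC] with z hz
        simp [hF, hχ0 z hz]
      exact contMDiffAt_const.congr_of_eventuallyEq hev
  have hFmin : IsMaxOn (fun y ↦ -F y) univ x := by
    intro y _
    show -F y ≤ -F x
    have hFx0 : F x = f x := by simp [hF]
    rw [hFx0, neg_le_neg_iff]
    by_cases hy : y ∈ O
    · have h1 := (hO y hy).2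
      have h2 := (hχ01 y).1
      have h3 : 0 ≤ χ y * (f y - f x) := mul_nonneg h2 (sub_nonneg.2 h1)
      show f x ≤ f x + χ y * (f y - f x)
      linarith
    · have hyC : y ∉ C := fun h ↦ hy (hCO h)
      simp [hF, hχ0 y hyC]
  have hpos : ∀ v : TangentSpace I x, v ≠ 0 → 0 < g.val x v v := fun v hv ↦ hg x v hv
  have key := laplaceBeltrami_nonpos_of_isMaxOn g hpos (f := fun y ↦ -F y) hFs.neg hFmin
  -- `Δ(−F) = −ΔF` and `ΔF(x) = Δf(x)` (locality: `F = f` near `x`)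
  have hFx : ContMDiffAt I 𝓘(ℝ, ℝ) 2 F x := hFs x
  have hneg : g.laplaceBeltrami (fun y ↦ -F y) x = -g.laplaceBeltrami F x := by
    rw [laplaceBeltrami_eq_dalembertian, laplaceBeltrami_eq_dalembertian]
    have := g.dalembertian_const_mul_of_contMDiffAt hFx (-1)
    simp only [neg_mul, one_mul] at this
    exact this
  have hloc : g.laplaceBeltrami F x = g.laplaceBeltrami f x := by
    rw [laplaceBeltrami_eq_dalembertian, laplaceBeltrami_eq_dalembertian]
    refine g.dalembertian_congr_of_eventuallyEq ?_
    filter_upwards [hχ1.self_of_nhdsSet x (mem_singleton x) |> fun h ↦ (show ∀ᶠ z in 𝓝 x, χ z = 1 from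
      by
        have := hχ1
        rw [nhdsSet_singleton] at this
        exact this)] with z hz
    simp [hF, hz]
  rw [hneg, hloc] at key
  linarith

end LocalMin

/-- **`φ′(t₀) ≤ 0` at a minimum from the left**: if `φ(t) ≥ φ(t₀)` for `t < t₀` close to `t₀` and
`φ` is differentiable at `t₀`, then `φ′(t₀) ≤ 0`. [folklore] -/
theorem hasDerivAt_nonpos_of_isLocalMin_left {φ : ℝ → ℝ} {t₀ d : ℝ} (hφ : HasDerivAt φ d t₀)
    (hmin : ∀ᶠ t in 𝓝[<] t₀, φ t₀ ≤ φ t) : d ≤ 0 := by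
  have hslope : Tendsto (slope φ t₀) (𝓝[<] t₀) (𝓝 d) :=
    (hasDerivAt_iff_tendsto_slope.1 hφ).mono_left (nhdsWithin_mono _ fun t ht ↦ ne_of_lt ht)
  refine le_of_tendsto hslope ?_
  filter_upwards [hmin, self_mem_nhdsWithin] with t ht ht'
  rw [slope_def_field]
  have ht'' : t < t₀ := ht'
  exact div_nonpos_of_nonneg_of_nonpos (by linarith) (by linarith)

section Comparison

variable {m : ℕ} {H : Type*} [TopologicalSpace H]
  {I : ModelWithCorners ℝ (EuclideanSpace ℝ (Fin m)) H} [I.Boundaryless]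
  {M : Type*} [TopologicalSpace M] [ChartedSpace H M] [IsManifold I ∞ M]
  [T2Space M] [CompactSpace M]
  {h : ℝ → PseudoRiemannianMetric I ∞ (EuclideanSpace ℝ (Fin m)) (TangentSpace I : M → Type _)}

/-- **The minimum principle against a supersolution in the barrier sense** (the comparison step
of Bamler 2020a, Cor. 3.6, on `M × M × [t₁, t₂]`). Let `h` be a family of Riemannian metrics on a
compact manifold, `ψ, U : M → M → ℝ → ℝ` continuous on `M × M × [t₁, t₂]`, `U` with `C²` slices
in `x` and in `y` and `∂ₜU = Δ_x U + Δ_y U` (genuine time derivative) at all `(x, y, t)`,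
`t ∈ (t₁, t₂]`, and `U(·, ·, t₁) ≤ ψ(·, ·, t₁)`. If at every `(x, y, t)`, `t ∈ (t₁, t₂]`, and for
every `η > 0` there is an upper barrier `b ≥ ψ` near `(x, y, t)`, touching at the point, with `C²`
slices and `∂ₜb − Δ_x b − Δ_y b ≥ −c − η` there, then `U ≤ ψ + c (t − t₁)` on
`M × M × [t₁, t₂]`. [cite: Bamler2020Entropy, §3, proof of Cor. 3.6] -/
theorem barrier_minimum_principle (hR : ∀ r, (h r).IsRiemannian) {t₁ t₂ : ℝ}
    {ψ U : M → M → ℝ → ℝ}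
    (hψc : ContinuousOn (fun p : M × M × ℝ ↦ ψ p.1 p.2.1 p.2.2) (univ ×ˢ univ ×ˢ Icc t₁ t₂))
    (hUc : ContinuousOn (fun p : M × M × ℝ ↦ U p.1 p.2.1 p.2.2) (univ ×ˢ univ ×ˢ Icc t₁ t₂))
    (hUx : ∀ y, ∀ t ∈ Ioc t₁ t₂, ContMDiff I 𝓘(ℝ, ℝ) 2 fun x ↦ U x y t)
    (hUy : ∀ x, ∀ t ∈ Ioc t₁ t₂, ContMDiff I 𝓘(ℝ, ℝ) 2 fun y ↦ U x y t)
    (hUt : ∀ x y, ∀ t ∈ Ioc t₁ t₂, HasDerivAt (fun s ↦ U x y s)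
      ((h t).laplaceBeltrami (fun x' ↦ U x' y t) x + (h t).laplaceBeltrami (fun y' ↦ U x y' t) y) t)
    {c : ℝ}
    (hbar : ∀ x y, ∀ t ∈ Ioc t₁ t₂, ∀ η > 0, ∃ b : M → M → ℝ → ℝ,
      (∀ᶠ p in 𝓝 ((x, y, t) : M × M × ℝ), ψ p.1 p.2.1 p.2.2 ≤ b p.1 p.2.1 p.2.2) ∧
      b x y t = ψ x y t ∧
      (∀ᶠ x' in 𝓝 x, ContMDiffAt I 𝓘(ℝ, ℝ) 2 (fun x'' ↦ b x'' y t) x') ∧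
      (∀ᶠ y' in 𝓝 y, ContMDiffAt I 𝓘(ℝ, ℝ) 2 (fun y'' ↦ b x y'' t) y') ∧
      ∃ db : ℝ, HasDerivAt (fun s ↦ b x y s) db t ∧
        -c - η ≤ db - (h t).laplaceBeltrami (fun x' ↦ b x' y t) x -
          (h t).laplaceBeltrami (fun y' ↦ b x y' t) y)
    (h0 : ∀ x y, U x y t₁ ≤ ψ x y t₁) :
    ∀ x y, ∀ t ∈ Icc t₁ t₂, U x y t ≤ ψ x y t + c * (t - t₁) := by
  -- it suffices to prove the bound with `c + δ` for every `δ > 0`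
  suffices hδ : ∀ δ > 0, ∀ x y, ∀ t ∈ Icc t₁ t₂, U x y t ≤ ψ x y t + (c + δ) * (t - t₁) by
    intro x y t ht
    refine le_of_forall_pos_le_add fun ε hε ↦ ?_
    rcases eq_or_lt_of_le ht.1 with heq | hlt
    · subst heq; have := h0 x y; linarith
    · have := hδ (ε / (t - t₁)) (by positivity) x y t ht
      rw [add_mul, div_mul_cancel₀ _ (by linarith)] at this
      linarith
  intro δ hδ x y t ht
  by_contra hneg
  rw [not_le] at hneg
  -- `W = ψ + (c + δ)(t − t₁) − U` attains a negative minimum on the compact slab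
  set K : Set (M × M × ℝ) := univ ×ˢ univ ×ˢ Icc t₁ t₂ with hK
  have hKc : IsCompact K := isCompact_univ.prod (isCompact_univ.prod isCompact_Icc)
  set W : M × M × ℝ → ℝ := fun p ↦ ψ p.1 p.2.1 p.2.2 + (c + δ) * (p.2.2 - t₁) - U p.1 p.2.1 p.2.2 with hW
  have hWc : ContinuousOn W K :=
    (hψc.add (continuousOn_const.mul ((continuous_snd.comp continuous_snd).continuousOn.sub
      continuousOn_const))).sub hUc
  obtain ⟨p₀, hp₀K, hp₀⟩ := hKc.exists_isMinOn ⟨(x, y, t), mem_univ _, mem_univ _, ht⟩ hWc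
  have hWneg : W p₀ < 0 := by
    have h1 : W p₀ ≤ W (x, y, t) := hp₀ (show ((x, y, t) : M × M × ℝ) ∈ K from ⟨mem_univ _, mem_univ _, ht⟩)
    have h2 : W (x, y, t) < 0 := by simp only [hW]; linarith
    exact h1.trans_lt h2
  obtain ⟨x₀, y₀, t₀⟩ := p₀
  obtain ⟨-, -, ht₀⟩ := hp₀K
  simp only at ht₀ hWneg
  -- `t₀ > t₁`
  have ht₀1 : t₁ < t₀ := by
    rcases eq_or_lt_of_le ht₀.1 with heq | hlt
    · exfalso
      have := h0 x₀ y₀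
      simp only [hW, ← heq, sub_self, mul_zero, add_zero] at hWneg
      linarith
    · exact hlt
  have ht₀' : t₀ ∈ Ioc t₁ t₂ := ⟨ht₀1, ht₀.2⟩
  -- the barrier at `(x₀, y₀, t₀)` with `η = δ/2`
  obtain ⟨b, hbψ, hbeq, hbx, hby, db, hdb, hbineq⟩ := hbar x₀ y₀ t₀ ht₀' (δ / 2) (by positivity)
  -- `Ψ = b + (c+δ)(t − t₁) − U ≥ W ≥ W p₀ = Ψ p₀` near `p₀` inside the slab
  set Ψ : M × M × ℝ → ℝ := fun p ↦ b p.1 p.2.1 p.2.2 + (c + δ) * (p.2.2 - t₁) - U p.1 p.2.1 p.2.2 with hΨ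
  have hΨmin : ∀ᶠ p in 𝓝 ((x₀, y₀, t₀) : M × M × ℝ), p ∈ K → Ψ (x₀, y₀, t₀) ≤ Ψ p := by
    filter_upwards [hbψ] with p hp hpK
    have h1 : W (x₀, y₀, t₀) ≤ W p := hp₀ hpK
    have h2 : Ψ (x₀, y₀, t₀) = W (x₀, y₀, t₀) := by simp [hΨ, hW, hbeq]
    have h3 : W p ≤ Ψ p := by simp only [hΨ, hW]; linarith
    linarith
  -- (i) the `x`-slice has a local minimum at `x₀`
  have hix : 0 ≤ (h t₀).laplaceBeltrami (fun x' ↦ b x' y₀ t₀) x₀ -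
      (h t₀).laplaceBeltrami (fun x' ↦ U x' y₀ t₀) x₀ := by
    have hsl : IsLocalMin (fun x' ↦ Ψ (x', y₀, t₀)) x₀ := by
      have hc : Continuous fun x' : M ↦ ((x', y₀, t₀) : M × M × ℝ) :=
        continuous_id.prodMk continuous_const
      have := hc.continuousAt.eventually hΨmin
      filter_upwards [this] with x' hx'
      exact hx' ⟨mem_univ _, mem_univ _, ht₀⟩
    have hb2 : ContMDiffAt I 𝓘(ℝ, ℝ) 2 (fun x'' ↦ b x'' y₀ t₀) x₀ := hbx.self_of_nhds
    have hU2 : ContMDiffAt I 𝓘(ℝ, ℝ) 2 (fun x'' ↦ U x'' y₀ t₀) x₀ := hUx y₀ t₀ ht₀' x₀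
    have hΨx : (fun x'' ↦ Ψ (x'', y₀, t₀)) =
        fun x'' ↦ (b x'' y₀ t₀ + (c + δ) * (t₀ - t₁)) + (-1) * U x'' y₀ t₀ := by
      funext x''; simp only [hΨ]; ring
    have hreg : ∀ᶠ x' in 𝓝 x₀, ContMDiffAt I 𝓘(ℝ, ℝ) 2 (fun x'' ↦ Ψ (x'', y₀, t₀)) x' := by
      filter_upwards [hbx] with x' hx'
      rw [hΨx]
      exact (hx'.add contMDiffAt_const).add (contMDiffAt_const.mul (hUx y₀ t₀ ht₀' x'))
    have key := laplaceBeltrami_nonneg_of_isLocalMin (h t₀) (hR t₀) hreg hsl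
    -- linearity of `Δ` at `x₀`
    haveI := (h t₀).hasLeviCivita
    haveI : Fact (1 ≤ (∞ : ℕ∞ω)) := ⟨by exact_mod_cast le_top⟩
    have hu : ContMDiffAt I 𝓘(ℝ, ℝ) 2 (fun x'' ↦ b x'' y₀ t₀ + (c + δ) * (t₀ - t₁)) x₀ :=
      hb2.add contMDiffAt_const
    have e1 : (h t₀).laplaceBeltrami (fun x'' ↦ Ψ (x'', y₀, t₀)) x₀ =
        (h t₀).laplaceBeltrami (fun x'' ↦ b x'' y₀ t₀ + (c + δ) * (t₀ - t₁)) x₀ +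
          (-1) * (h t₀).laplaceBeltrami (fun x'' ↦ U x'' y₀ t₀) x₀ := by
      rw [laplaceBeltrami_eq_dalembertian, laplaceBeltrami_eq_dalembertian,
        laplaceBeltrami_eq_dalembertian, hΨx]
      exact (h t₀).dalembertian_add_const_mul_of_contMDiffAt hu hU2 (-1)
    have e2 : (h t₀).laplaceBeltrami (fun x'' ↦ b x'' y₀ t₀ + (c + δ) * (t₀ - t₁)) x₀ =
        (h t₀).laplaceBeltrami (fun x'' ↦ b x'' y₀ t₀) x₀ := by
      have := (h t₀).dalembertian_add_const_mul_of_contMDiffAt hb2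
        (contMDiffAt_const (c := (1 : ℝ))) ((c + δ) * (t₀ - t₁))
      simp only [mul_one] at this
      rw [laplaceBeltrami_eq_dalembertian, laplaceBeltrami_eq_dalembertian, this,
        ← laplaceBeltrami_eq_dalembertian (h t₀) (fun _ ↦ (1 : ℝ)), laplaceBeltrami_const_fun]
      ring
    rw [e1, e2] at key
    linarith
  -- (ii) the `y`-slice
  have hiy : 0 ≤ (h t₀).laplaceBeltrami (fun y' ↦ b x₀ y' t₀) y₀ -
      (h t₀).laplaceBeltrami (fun y' ↦ U x₀ y' t₀) y₀ := by
    have hsl : IsLocalMin (fun y' ↦ Ψ (x₀, y', t₀)) y₀ := by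
      have hc : Continuous fun y' : M ↦ ((x₀, y', t₀) : M × M × ℝ) :=
        continuous_const.prodMk (continuous_id.prodMk continuous_const)
      have := hc.continuousAt.eventually hΨmin
      filter_upwards [this] with y' hy'
      exact hy' ⟨mem_univ _, mem_univ _, ht₀⟩
    have hb2 : ContMDiffAt I 𝓘(ℝ, ℝ) 2 (fun y'' ↦ b x₀ y'' t₀) y₀ := hby.self_of_nhds
    have hU2 : ContMDiffAt I 𝓘(ℝ, ℝ) 2 (fun y'' ↦ U x₀ y'' t₀) y₀ := hUy x₀ t₀ ht₀' y₀
    have hΨy : (fun y'' ↦ Ψ (x₀, y'', t₀)) =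
        fun y'' ↦ (b x₀ y'' t₀ + (c + δ) * (t₀ - t₁)) + (-1) * U x₀ y'' t₀ := by
      funext y''; simp only [hΨ]; ring
    have hreg : ∀ᶠ y' in 𝓝 y₀, ContMDiffAt I 𝓘(ℝ, ℝ) 2 (fun y'' ↦ Ψ (x₀, y'', t₀)) y' := by
      filter_upwards [hby] with y' hy'
      rw [hΨy]
      exact (hy'.add contMDiffAt_const).add (contMDiffAt_const.mul (hUy x₀ t₀ ht₀' y'))
    have key := laplaceBeltrami_nonneg_of_isLocalMin (h t₀) (hR t₀) hreg hsl
    haveI := (h t₀).hasLeviCivita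
    haveI : Fact (1 ≤ (∞ : ℕ∞ω)) := ⟨by exact_mod_cast le_top⟩
    have hu : ContMDiffAt I 𝓘(ℝ, ℝ) 2 (fun y'' ↦ b x₀ y'' t₀ + (c + δ) * (t₀ - t₁)) y₀ :=
      hb2.add contMDiffAt_const
    have e1 : (h t₀).laplaceBeltrami (fun y'' ↦ Ψ (x₀, y'', t₀)) y₀ =
        (h t₀).laplaceBeltrami (fun y'' ↦ b x₀ y'' t₀ + (c + δ) * (t₀ - t₁)) y₀ +
          (-1) * (h t₀).laplaceBeltrami (fun y'' ↦ U x₀ y'' t₀) y₀ := by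
      rw [laplaceBeltrami_eq_dalembertian, laplaceBeltrami_eq_dalembertian,
        laplaceBeltrami_eq_dalembertian, hΨy]
      exact (h t₀).dalembertian_add_const_mul_of_contMDiffAt hu hU2 (-1)
    have e2 : (h t₀).laplaceBeltrami (fun y'' ↦ b x₀ y'' t₀ + (c + δ) * (t₀ - t₁)) y₀ =
        (h t₀).laplaceBeltrami (fun y'' ↦ b x₀ y'' t₀) y₀ := by
      have := (h t₀).dalembertian_add_const_mul_of_contMDiffAt hb2
        (contMDiffAt_const (c := (1 : ℝ))) ((c + δ) * (t₀ - t₁))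
      simp only [mul_one] at this
      rw [laplaceBeltrami_eq_dalembertian, laplaceBeltrami_eq_dalembertian, this,
        ← laplaceBeltrami_eq_dalembertian (h t₀) (fun _ ↦ (1 : ℝ)), laplaceBeltrami_const_fun]
      ring
    rw [e1, e2] at key
    linarith
  -- (iii) the `t`-slice: minimum from the left
  have hit : db + (c + δ) - ((h t₀).laplaceBeltrami (fun x' ↦ U x' y₀ t₀) x₀ +
      (h t₀).laplaceBeltrami (fun y' ↦ U x₀ y' t₀) y₀) ≤ 0 := by
    have hd : HasDerivAt (fun s ↦ Ψ (x₀, y₀, s))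
        (db + (c + δ) - ((h t₀).laplaceBeltrami (fun x' ↦ U x' y₀ t₀) x₀ +
          (h t₀).laplaceBeltrami (fun y' ↦ U x₀ y' t₀) y₀)) t₀ := by
      have h1 := (hdb.add (((hasDerivAt_id t₀).sub_const t₁).const_mul (c + δ))).sub
        (hUt x₀ y₀ t₀ ht₀')
      simp only [mul_one] at h1
      exact h1
    refine hasDerivAt_nonpos_of_isLocalMin_left hd ?_
    have hc : Continuous fun s : ℝ ↦ ((x₀, y₀, s) : M × M × ℝ) :=
      continuous_const.prodMk (continuous_const.prodMk continuous_id)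
    have h1 := (hc.continuousAt.eventually hΨmin)
    have h2 : ∀ᶠ s in 𝓝[<] t₀, s ∈ Icc t₁ t₂ := by
      filter_upwards [Ioo_mem_nhdsLT ht₀1] with s hs
      exact ⟨hs.1.le, hs.2.le.trans ht₀.2⟩
    filter_upwards [eventually_nhdsWithin_of_eventually_nhds h1, h2] with s hs hsI
    exact hs ⟨mem_univ _, mem_univ _, hsI⟩
  -- contradiction
  linarith

end Comparison

end Literature.Geometry.Riemannian

end
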